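import Literature.AnabelianGeometry.EtaleTheta.Discharge.Sec3Prop34iDivPlus
import Literature.AlgebraicGeometry.Frobenioids.PiNatPerfFactorialDichotomy
import HarnessLib

/-!
# [EtTh] Prop. 3.4 (i) for `Div⁺(Z^log_∞)` AS PRINTED ([FrdI] Def. 2.4 (i) with clause (d), the tree's
# `treeMonoidVocab`): TRUE iff the prime log-divisors are FINITE in number — the interface-level form of F-L2d2-1

Mochizuki, *The étale theta function …*, Publ. RIMS **45** (2009), §3, Prop. 3.4 (i) PDF p. 74 ("each of the
monoids `Div⁺(Z^log_∞)^{Gal(Z^log_∞/Y^log)}` … is perf-factorial"), Prop. 3.2 (i) p. 70, Def. 3.1 (i) p. 70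
[cite: MochizukiEtTh2009, Prop 3.4 p.74]; Mochizuki, *The geometry of Frobenioids I*, Kyushu J. Math. **62**
(2008), Def. 2.4 (i) p. 47 [cite: MochizukiFrdI2008, Def. 2.4(i) p.47].

abc-iut cell, W6 cone prover abc-iut-w6-d057, row EtTh:Prop3.4(i) — the NEGATIVE TWIN of `Sec3Prop34iDivPlus.lean`
(p433424, where the clause is PROVED in the weak vocabulary of record).  Finding F-L2d2-1 (abc-iut-L2-d2): the
printed notion fails for `∏_ℕ ℤ≥0`.  THIS PROOF-ONLY FILE (theorems only) settles the printed reading AT THE TYPED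
INTERFACE `LogDivisorModel`, for every model:

* `LogDivisorModel.isPerfFactorial_DIVplus_iff_finite` — `DIV⁺(Z^log_∞) ≅ ∏_{Cusp ⊔ Comp} ℤ≥0` is perf-factorial
  as printed iff `Cusp ⊔ Comp` is finite (`PiNat.isPerfFactorial_iff_finite`);
* **`LogDivisorModel.isPerfFactorial_Divplus_iff_finite`** — the SAME for `Div⁺(Z^log_∞)` (the printed notion is
  invariant along the group-saturated perf-dense inclusion `Div⁺ ⊆ DIV⁺` of Prop. 3.2 (i):
  `GroupSaturatedSubmonoid.isPerfFactorial_iff`), i.e. **`prop34_i_Divplus_printed_iff_finite :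
  treeMonoidVocab.IsPerfFactorial ↥Z.Divplus ↔ Finite (Z.Cusp ⊕ Z.Comp)`**;
* `LogDivisorModel.not_isPerfFactorial_Divplus_of_infinite` — in particular Prop. 3.4 (i) AS PRINTED FAILS at every
  `LogDivisorModel` with infinitely many irreducible components of the special fibre (the case of the universal
  combinatorial covering of a Tate curve: an infinite chain of `ℙ¹`'s), and `…_of_finite` — it HOLDS when cusps and
  components are finite in number.

So at the interface: weak reading always true (p433424/p433826), printed reading true exactly in the finite case.
HONEST FRAMING: statements about the typed interface and a classical definition; the cell reads [EtTh] §3 with the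
weak vocabulary (F-L2d2-1/F-L2d2-2); nothing asserts that a `LogDivisorModel` arises from a curve; no side is taken
on [IUTchIII] Cor. 3.12; typed ≠ proved for anything else.
-/

noncomputable section

namespace Literature.AlgebraicGeometry.Frobenioids

open Function

universe u

/-- [FrdI] Def. 2.4 (i) (printed, with (d)) is invariant under isomorphisms of monoids ((a), (b) by
`MonoidTransport`, (c)(d) by `Factorization.Cond.of_mulEquiv` on `M^pf ≅ M'^pf`) — local copy of the L6-side
`IsPerfFactorial.of_mulEquiv` (`GlobalLGPFrobenioidsModFrakPerfFactorial.lean`), kept private here to avoid an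
upward import. [cite: MochizukiFrdI2008, Def. 2.4(i) p.47] -/
private theorem isPerfFactorial_transport {M M' : Type u} [CommMonoid M] [CommMonoid M'] (e : M ≃* M')
    (h : IsPerfFactorial M) : IsPerfFactorial M' := by
  refine IsPerfFactorial.of_cond (h.isDivisorial.of_mulEquiv e) (fun 𝔭' => ?_)
    (Factorization.Cond.of_mulEquiv (Perfection.congr e) h.cond)
  exact (h.isMonoprime (Primes.congr e.symm 𝔭')).of_mulEquiv
    (Primes.submonoidCongr e (Primes.congr e.symm 𝔭') 𝔭' (Primes.congr_apply_congr_symm e 𝔭'))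

end Literature.AlgebraicGeometry.Frobenioids

namespace Literature.AnabelianGeometry.EtaleTheta

open Literature.AlgebraicGeometry.Frobenioids Function

universe u

namespace LogDivisorModel

variable (Z : LogDivisorModel.{u})

/-- **`DIV⁺(Z^log_∞)` is perf-factorial as printed iff `Cusp ⊔ Comp` is finite** (`DIV⁺ ≅ ∏_{Cusp ⊔ Comp} ℤ≥0`,
`PiNat.isPerfFactorial_iff_finite`). [cite: MochizukiEtTh2009, Prop 3.2 p.70] -/
theorem isPerfFactorial_DIVplus_iff_finite : IsPerfFactorial ↥Z.DIVplus ↔ Finite (Z.Cusp ⊕ Z.Comp) := by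
  obtain ⟨e⟩ := Z.nonempty_piNatEquivDIVplus
  rw [← PiNat.isPerfFactorial_iff_finite]
  exact ⟨fun h => isPerfFactorial_transport e.symm h, fun h => isPerfFactorial_transport e h⟩

/-- **`Div⁺(Z^log_∞)` is perf-factorial AS PRINTED iff `Cusp ⊔ Comp` is finite** — the printed notion passes along
the group-saturated perf-dense inclusion `Div⁺ ⊆ DIV⁺` (Prop. 3.2 (i)) in both directions.
[cite: MochizukiEtTh2009, Prop 3.4 p.74] -/
theorem isPerfFactorial_Divplus_iff_finite : IsPerfFactorial ↥Z.Divplus ↔ Finite (Z.Cusp ⊕ Z.Comp) := by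
  obtain ⟨ec⟩ := Z.nonempty_divplusComapEquiv
  rw [← Z.isPerfFactorial_DIVplus_iff_finite,
    ← GroupSaturatedSubmonoid.isPerfFactorial_iff Z.isPerfFactorialWeak_DIVplus.isDivisorial
      Z.isZMonoprime_submonoid_primes_DIVplus Z.isGroupSaturated_Divplus_comap Z.mem_perfSaturation_Divplus_comap]
  exact ⟨fun h => isPerfFactorial_transport ec.symm h, fun h => isPerfFactorial_transport ec h⟩

/-- **[EtTh] Prop. 3.4 (i) for `Div⁺(Z^log_∞)` AS PRINTED fails whenever the special fibre has infinitely many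
irreducible components** (F-L2d2-1 at the interface). [cite: MochizukiEtTh2009, Prop 3.4 p.74] -/
theorem not_isPerfFactorial_Divplus_of_infinite [Infinite Z.Comp] : ¬ IsPerfFactorial ↥Z.Divplus := fun h =>
  (not_finite_iff_infinite.mpr (inferInstance : Infinite (Z.Cusp ⊕ Z.Comp)))
    (Z.isPerfFactorial_Divplus_iff_finite.mp h)

/-- … and likewise with infinitely many cusps. [cite: MochizukiEtTh2009, Prop 3.4 p.74] -/
theorem not_isPerfFactorial_Divplus_of_infinite_cusp [Infinite Z.Cusp] : ¬ IsPerfFactorial ↥Z.Divplus := fun h =>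
  (not_finite_iff_infinite.mpr (inferInstance : Infinite (Z.Cusp ⊕ Z.Comp)))
    (Z.isPerfFactorial_Divplus_iff_finite.mp h)

/-- **[EtTh] Prop. 3.4 (i) for `Div⁺(Z^log_∞)` AS PRINTED holds when cusps and components are finite in number.**
[cite: MochizukiEtTh2009, Prop 3.4 p.74] -/
theorem isPerfFactorial_Divplus_of_finite [Finite Z.Cusp] [Finite Z.Comp] : IsPerfFactorial ↥Z.Divplus :=
  Z.isPerfFactorial_Divplus_iff_finite.mpr inferInstance

/-- **The printed reading of Prop. 3.4 (i) at the interface, in the printed vocabulary `treeMonoidVocab`**: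
`Div⁺(Z^log_∞)` is perf-factorial in the sense of [FrdI] Def. 2.4 (i) (with (d)) iff `Cusp ⊔ Comp` is finite.
Contrast: in the weak vocabulary of record it holds for EVERY model (`prop34_i_Divplus`, p433424).
[cite: MochizukiEtTh2009, Prop 3.4 p.74] -/
theorem prop34_i_Divplus_printed_iff_finite :
    treeMonoidVocab.IsPerfFactorial ↥Z.Divplus ↔ Finite (Z.Cusp ⊕ Z.Comp) := by
  rw [treeMonoidVocab_isPerfFactorial]
  exact Z.isPerfFactorial_Divplus_iff_finite

end LogDivisorModel

end Literature.AnabelianGeometry.EtaleTheta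

end
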